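import Mathlib

/-!
# The reflex field of a CM type, on honest Galois fields

For a Galois CM field `K/ℚ` with group `G = Gal(K/ℚ)` and a set `Φ ⊆ G` of embeddings (a CM type,
read through a base point as in `CMFieldGalois.lean`), Shimura–Taniyama define the **reflex field**
`K^* := ℚ((∑_{σ ∈ Φ} σ(a))_{a ∈ K})`, the field generated by the traces of the type
(Shimura 1998 §8.3; Deligne LNM 900 Ex. 3.7 / §5), and show that it is the fixed field of the
stabiliser `{g ∈ G : g Φ = Φ}` of `Φ` under left translation (conjugating the embeddings).
ROUTE.md uses this in R0 ("a CM field `E` containing every reflex field `K_j^*`") and in the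
reflex-type bookkeeping of C5′ / C7; `Reflex.lean` has the group-model reflex type.

This file kernel-checks the characterisation on honest fields:

* `reflexField Φ : IntermediateField ℚ K` — the field generated by the traces `∑_{σ ∈ Φ} σ a`;
* `stab Φ : Subgroup (K ≃ₐ[ℚ] K)` — the stabiliser of `Φ` under left translation `g • Φ`;
* `fixingSubgroup_reflexField : fixingSubgroup (reflexField Φ) = stab Φ` — the group fixing every
  trace is exactly the stabiliser (⊆ by Dedekind's independence of characters: a sum of distinct
  automorphisms determines its index set; ⊇ by re-indexing the sum);
* **`reflexField_eq_fixedField : reflexField Φ = fixedField (stab Φ)`** — by the Galois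
  correspondence (`IsGalois.fixedField_fixingSubgroup`), the reflex field is the fixed field of the
  stabiliser.  Consequently `[K^* : ℚ] = [G : stab Φ]` (`finrank_reflexField`).

Nothing here needs `K` to be CM or `Φ` to be a CM type: it is a statement about any finite
Galois extension of `ℚ` and any finite set of its automorphisms (so it also covers the reflex
field of an induced type, read on the Galois closure).
-/

namespace HodgeRepro.ReflexField

open IntermediateField Finset
open scoped Pointwise

variable {K : Type*} [Field K] [Algebra ℚ K] [FiniteDimensional ℚ K] [IsGalois ℚ K]

/-- The trace of `Φ` at `a`: `∑_{σ ∈ Φ} σ a`. -/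
def traceOf (Φ : Finset (K ≃ₐ[ℚ] K)) (a : K) : K := ∑ σ ∈ Φ, σ a

/-- **The reflex field** `K^* = ℚ((∑_{σ ∈ Φ} σ a)_a)`. -/
noncomputable def reflexField (Φ : Finset (K ≃ₐ[ℚ] K)) : IntermediateField ℚ K :=
  IntermediateField.adjoin ℚ (Set.range (traceOf Φ))

/-- The stabiliser of `Φ` under left translation (`g • Φ = {g ∘ σ : σ ∈ Φ}`). -/
def stab [DecidableEq (K ≃ₐ[ℚ] K)] (Φ : Finset (K ≃ₐ[ℚ] K)) : Subgroup (K ≃ₐ[ℚ] K) :=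
  MulAction.stabilizer (K ≃ₐ[ℚ] K) Φ

omit [FiniteDimensional ℚ K] [IsGalois ℚ K] in
/-- Membership in the stabiliser. -/
theorem mem_stab [DecidableEq (K ≃ₐ[ℚ] K)] (Φ : Finset (K ≃ₐ[ℚ] K)) (g : K ≃ₐ[ℚ] K) :
    g ∈ stab Φ ↔ g • Φ = Φ :=
  MulAction.mem_stabilizer_iff

omit [FiniteDimensional ℚ K] [IsGalois ℚ K] in
/-- `g (traceOf Φ a) = traceOf (g • Φ) a`: conjugating the embeddings translates the type. -/
theorem map_traceOf [DecidableEq (K ≃ₐ[ℚ] K)] (Φ : Finset (K ≃ₐ[ℚ] K)) (g : K ≃ₐ[ℚ] K) (a : K) :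
    g (traceOf Φ a) = traceOf (g • Φ) a := by
  unfold traceOf
  rw [map_sum, Finset.smul_finset_def, Finset.sum_image]
  · simp only [smul_eq_mul, AlgEquiv.mul_apply]
  · intro x _ y _ h
    exact smul_left_cancel _ h

omit [IsGalois ℚ K] in
/-- **Dedekind**: two finite sets of automorphisms with the same trace function are equal
(distinct automorphisms are linearly independent as functions `K → K`). -/
theorem eq_of_traceOf_eq [DecidableEq (K ≃ₐ[ℚ] K)] {Φ Ψ : Finset (K ≃ₐ[ℚ] K)}
    (h : ∀ a, traceOf Φ a = traceOf Ψ a) : Φ = Ψ := by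
  have hli : LinearIndependent K (fun σ : K ≃ₐ[ℚ] K => (σ : K → K)) := by
    have h1 := linearIndependent_monoidHom K K
    have hinj : Function.Injective fun σ : K ≃ₐ[ℚ] K => (σ : K →* K) := by
      intro σ τ hστ
      ext x
      exact DFunLike.congr_fun hστ x
    exact h1.comp _ hinj
  set c : (K ≃ₐ[ℚ] K) → K := fun σ => (if σ ∈ Φ then 1 else 0) - (if σ ∈ Ψ then 1 else 0) with hc
  have hsum : ∑ σ, c σ • (σ : K → K) = 0 := by
    funext a
    simp only [Finset.sum_apply, Pi.smul_apply, smul_eq_mul, Pi.zero_apply, hc, sub_mul, ite_mul,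
      one_mul, zero_mul, Finset.sum_sub_distrib, Finset.sum_ite_mem, Finset.univ_inter]
    exact sub_eq_zero.2 (h a)
  have hc0 := Fintype.linearIndependent_iff.1 hli c hsum
  ext σ
  have hσ := hc0 σ
  simp only [hc] at hσ
  by_cases hΦ : σ ∈ Φ <;> by_cases hΨ : σ ∈ Ψ <;> simp [hΦ, hΨ] at hσ ⊢

variable [DecidableEq (K ≃ₐ[ℚ] K)]

omit [FiniteDimensional ℚ K] [IsGalois ℚ K] in
/-- The reflex field is fixed by the stabiliser. -/
theorem reflexField_le_fixedField (Φ : Finset (K ≃ₐ[ℚ] K)) :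
    reflexField Φ ≤ fixedField (stab Φ) := by
  unfold reflexField
  rw [adjoin_le_iff]
  rintro _ ⟨a, rfl⟩
  rw [SetLike.mem_coe, mem_fixedField_iff]
  intro g hg
  rw [map_traceOf, (mem_stab Φ g).1 hg]

omit [IsGalois ℚ K] in
/-- **The group fixing the reflex field is the stabiliser of the type.** -/
theorem fixingSubgroup_reflexField (Φ : Finset (K ≃ₐ[ℚ] K)) :
    fixingSubgroup (reflexField Φ) = stab Φ := by
  apply le_antisymm
  · intro g hg
    rw [IntermediateField.mem_fixingSubgroup_iff] at hg
    rw [mem_stab]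
    apply eq_of_traceOf_eq
    intro a
    rw [← map_traceOf]
    exact hg _ (subset_adjoin ℚ _ ⟨a, rfl⟩)
  · exact (le_iff_le _ _).1 (reflexField_le_fixedField Φ)

/-- **The reflex field is the fixed field of the stabiliser** (Shimura–Taniyama; Galois
correspondence). -/
theorem reflexField_eq_fixedField (Φ : Finset (K ≃ₐ[ℚ] K)) :
    reflexField Φ = fixedField (stab Φ) := by
  rw [← fixingSubgroup_reflexField, IsGalois.fixedField_fixingSubgroup]

/-- `[K : K^*] = |stab Φ|`, hence `[K^* : ℚ] = [G : stab Φ]`. -/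
theorem finrank_reflexField (Φ : Finset (K ≃ₐ[ℚ] K)) :
    Module.finrank (reflexField Φ) K = Nat.card (stab Φ) := by
  rw [reflexField_eq_fixedField, finrank_fixedField_eq_card]

end HodgeRepro.ReflexField
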